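import Mathlib
import Summits.ResolutionOfSingularities.ResolutionOfSingularities.Theorems.PAlterationAssemblyReduction
import Summits.ResolutionOfSingularities.ResolutionOfSingularities.Theorems.PAlterationAssemblyFrobenius
import Summits.ResolutionOfSingularities.ResolutionOfSingularities.Theorems.PAlterationAssemblyLevels
import Summits.ResolutionOfSingularities.ResolutionOfSingularities.Theorems.PAlterationPicoverToRadicialBottomFrobenius
import Summits.ResolutionOfSingularities.ResolutionOfSingularities.Theorems.PAlterationAssembly2
import Literature.AlgebraicGeometry.Motives.FrobeniusMorphism

/-!
# `PAlteration.PicoverToRadicialBottom`: the finitized Frobenius factor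

Route `ResolutionOfSingularities/pAlteration`, crux `PicoverToRadicialBottom`
(stmt-ResolutionOfSingularities-0556), line `theta-finite-cofinite-roots`, stub
`stub_finitizedFactor`.

Setting: `k` a field of characteristic `p`, `L ⊇ k` a field inside `k^{1/p^r}` of finite
codegree, presented by `ι = algebraMap k L` and a FINITE ring map `ψ : L → k` with
`ι ∘ ψ = Frob^r` on `L` and `ψ ∘ ι = Frob^r` on `k`; `f : X → Spec k` of finite type, `X`
integral of characteristic `p`; `g : X'' → X` finite, universally injective, surjective with a
Frobenius factor `h : X → X''`, `h ≫ g = F := powEndo X (p ^ r)`.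

Construction (global, no gluing): with `j := Spec ι : Spec L → Spec k` and
`sψ := Spec ψ : Spec k → Spec L` one has `sψ ≫ j = F_{Spec k}` (`powEndo_Spec`), so
`h ≫ g ≫ f = F_X ≫ f = f ≫ F_{Spec k} = (f ≫ sψ) ≫ j` (`powEndo_comp`) and `h`, `f ≫ sψ` induce
`H : X → P := X'' ×_{Spec k} Spec L`; since `X` is reduced, `H` factors through
`hL : X → P_red` (`exists_lift_reduced`). Then

* `hL` is universally injective: `hL ≫ (ι_red ≫ fst) = h` and `h ≫ g = F` is universally
  injective (cancellation, `universallyInjective_of_comp` from `PAlterationAssemblyLevels`);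
* `hL` is surjective: `ι_red ≫ fst` is injective (`j` is universally injective because `L/k` is
  purely inseparable) and `h` is surjective (`F` is the identity on points, `g` injective);
* `hL` is finite: integral because `h` is (`F` integral, `g` and `ι_red ≫ fst` separated) and
  locally of finite type because `hL ≫ (ι_red ≫ snd) = f ≫ sψ` is (`ψ` finite).
-/

noncomputable section

-- single-problem summit: the doubled namespace component `ResolutionOfSingularities` is forced
set_option linter.dupNamespace false

open CategoryTheory CategoryTheory.Limits AlgebraicGeometry TopologicalSpace Opposite
open Literature.AlgebraicGeometry.Motives
open Scheme.IdealSheafData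

namespace Summit.ResolutionOfSingularities.ResolutionOfSingularities.Theorems

/-- For a field `k` of characteristic `p` and ring maps `ι : k → L`, `ψ : L → k` with
`ψ ∘ ι = Frob^r` on `k`, the composite `Spec ψ ≫ Spec ι` is the `p ^ r`-th power endomorphism of
`Spec k`. [folklore] -/
theorem specMap_comp_specMap_eq_powEndo (p : ℕ) [Fact p.Prime] (k : Type) [Field k] [CharP k p]
    (L : Type) [Field L] [Algebra k L] (r : ℕ) (ψ : L →+* k)
    (hψ2 : ∀ a : k, ψ (algebraMap k L a) = a ^ p ^ r)
    (hk : (p : Γ(Spec (.of k), ⊤)) = 0) :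
    Spec.map (CommRingCat.ofHom ψ) ≫ Spec.map (CommRingCat.ofHom (algebraMap k L)) =
      powEndo (Spec (.of k)) (p ^ r) (pow_ne_zero r (Fact.out : p.Prime).ne_zero)
        (add_pow_prime_pow_sections _ p hk r) := by
  have haddk : ∀ a b : k, (a + b) ^ p ^ r = a ^ p ^ r + b ^ p ^ r :=
    fun a b => add_pow_char_pow a b p r
  rw [powEndo_Spec (p ^ r) _ k haddk, ← Spec.map_comp]
  congr 1
  ext a
  simp only [CommRingCat.hom_comp, CommRingCat.hom_ofHom, RingHom.comp_apply, hψ2,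
    powRingHom_apply]

/-- **S3 (finitized Frobenius factor).** With `L`, `ψ` as in S2 and a Frobenius factor
`h ≫ g = F^{p^r}`, there is a finite, universally injective, surjective morphism
`X ⟶ (X'' ⊗_k L)_red`. [folklore] -/
theorem stub_finitizedFactor : ∀ (p : ℕ) [Fact p.Prime] (k : Type) [Field k] [CharP k p]
    (L : Type) [Field L] [Algebra k L] (r : ℕ) (ψ : L →+* k),
    (∀ x : L, algebraMap k L (ψ x) = x ^ p ^ r) → (∀ a : k, ψ (algebraMap k L a) = a ^ p ^ r) →
    ψ.Finite → ∀ (X X'' : Scheme.{0}) [IsIntegral X] [IsIntegral X''] (f : X ⟶ Spec (.of k))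
    [LocallyOfFiniteType f] [QuasiCompact f] (g : X'' ⟶ X) [IsFinite g] [UniversallyInjective g]
    [Surjective g] (hX : (p : Γ(X, ⊤)) = 0) (h : X ⟶ X''),
    h ≫ g = powEndo X (p ^ r) (pow_ne_zero r (Fact.out : p.Prime).ne_zero)
      (add_pow_prime_pow_sections X p hX r) →
    ∃ hL : X ⟶ (vanishingIdeal (⊤ : Closeds
      ↑(pullback (g ≫ f) (Spec.map (CommRingCat.ofHom (algebraMap k L)))))).subscheme,
      IsFinite hL ∧ UniversallyInjective hL ∧ Surjective hL := by
  intro p _ k _ _ L _ _ r ψ hψ1 hψ2 hψf X X'' _ _ f _ _ g _ _ _ hX h hh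
  have hk : (p : Γ(Spec (.of k), ⊤)) = 0 := natCast_appTop_eq_zero p (𝟙 _)
  -- the square `h ≫ (g ≫ f) = (f ≫ Spec ψ) ≫ Spec ι`
  have w : h ≫ (g ≫ f) =
      (f ≫ Spec.map (CommRingCat.ofHom ψ)) ≫ Spec.map (CommRingCat.ofHom (algebraMap k L)) := by
    rw [← Category.assoc, hh, powEndo_comp (p ^ r) _ _ f (add_pow_prime_pow_sections _ p hk r),
      Category.assoc, specMap_comp_specMap_eq_powEndo p k L r ψ hψ2 hk]
  -- the induced morphism to the fibre product and its lift to the reduced subscheme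
  obtain ⟨hL, hhL⟩ := exists_lift_reduced (pullback.lift h (f ≫ Spec.map (CommRingCat.ofHom ψ)) w)
  have hLm : hL ≫ (vanishingIdeal (⊤ : Closeds
      ↑(pullback (g ≫ f) (Spec.map (CommRingCat.ofHom (algebraMap k L)))))).subschemeι ≫
        pullback.fst (g ≫ f) (Spec.map (CommRingCat.ofHom (algebraMap k L))) = h := by
    rw [← Category.assoc, hhL, pullback.lift_fst]
  have hLn : hL ≫ (vanishingIdeal (⊤ : Closeds
      ↑(pullback (g ≫ f) (Spec.map (CommRingCat.ofHom (algebraMap k L)))))).subschemeι ≫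
        pullback.snd (g ≫ f) (Spec.map (CommRingCat.ofHom (algebraMap k L))) =
      f ≫ Spec.map (CommRingCat.ofHom ψ) := by
    rw [← Category.assoc, hhL, pullback.lift_snd]
  -- abbreviations for the two projections of the reduced fibre product
  set m := (vanishingIdeal (⊤ : Closeds
      ↑(pullback (g ≫ f) (Spec.map (CommRingCat.ofHom (algebraMap k L)))))).subschemeι ≫
        pullback.fst (g ≫ f) (Spec.map (CommRingCat.ofHom (algebraMap k L)))
  set n := (vanishingIdeal (⊤ : Closeds
      ↑(pullback (g ≫ f) (Spec.map (CommRingCat.ofHom (algebraMap k L)))))).subschemeι ≫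
        pullback.snd (g ≫ f) (Spec.map (CommRingCat.ofHom (algebraMap k L)))
  refine ⟨hL, ?_, ?_, ?_⟩
  · -- finite = integral + locally of finite type
    rw [IsFinite.iff_isIntegralHom_and_locallyOfFiniteType]
    constructor
    · haveI : IsIntegralHom (h ≫ g) := by
        rw [hh]; exact isIntegralHom_powEndo X (p ^ r) _ _
      haveI : IsIntegralHom h := IsIntegralHom.of_comp h g
      haveI : IsIntegralHom (hL ≫ m) := by rw [hLm]; infer_instance
      exact IsIntegralHom.of_comp hL m
    · haveI : IsFinite (Spec.map (CommRingCat.ofHom ψ)) := by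
        rw [IsFinite.SpecMap_iff, CommRingCat.hom_ofHom]; exact hψf
      haveI : LocallyOfFiniteType (hL ≫ n) := by rw [hLn]; infer_instance
      exact locallyOfFiniteType_of_comp hL n
  · -- universally injective, by cancellation from `h ≫ g = F`
    haveI : UniversallyInjective (h ≫ g) := by
      rw [hh]; exact powEndo_universallyInjective' X p hX r
    haveI : UniversallyInjective h := universallyInjective_of_comp h g
    haveI : UniversallyInjective (hL ≫ m) := by rw [hLm]; infer_instance
    exact universallyInjective_of_comp hL m
  · -- surjective: `m` is injective and `h = hL ≫ m` is surjective
    haveI : UniversallyInjective (Spec.map (CommRingCat.ofHom (algebraMap k L))) :=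
      universallyInjective_specMap_of_pow_mem (algebraMap k L) p fun c => ⟨r, ψ c, hψ1 c⟩
    haveI : UniversallyInjective
        (pullback.fst (g ≫ f) (Spec.map (CommRingCat.ofHom (algebraMap k L)))) :=
      MorphismProperty.pullback_fst (P := @UniversallyInjective) _ _ ‹_›
    haveI : UniversallyInjective m :=
      MorphismProperty.comp_mem @UniversallyInjective _ _ inferInstance inferInstance
    have hsurj : Function.Surjective h := fun y => ⟨g y, g.injective (by
      rw [← Scheme.Hom.comp_apply, hh]; rfl)⟩
    refine ⟨fun z => ?_⟩
    obtain ⟨x, hx⟩ := hsurj (m z)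
    refine ⟨x, m.injective ?_⟩
    rw [← Scheme.Hom.comp_apply, hLm, hx]

end Summit.ResolutionOfSingularities.ResolutionOfSingularities.Theorems

end
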